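import Summits.PneNP.PneNP.Theses.RootDecompSpaceCeiling
import Literature.Computability.Complexity.PolyHierarchy
import Literature.Computability.Complexity.Oracle
import Literature.Computability.Complexity.OracleEmpty
import Literature.Computability.Complexity.OracleProofs
import Literature.Computability.Complexity.SpaceTMSAT
import Literature.Computability.Complexity.SpaceOracles
import Literature.Computability.Complexity.SpaceOraclesProofs
import Literature.Computability.Complexity.BakerGillSolovay
import Literature.Barriers.PneNP.Relativization

/-! # Root decomposition N3 (SpaceCeiling) — the SCOPE clause of the blocker certificate (law (xiii)-I/II)

Closes the aside item stmt-PneNP-32377 `CertificateScope` of route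
`route-PneNP-RootDecompSpaceCeiling` (cycle-2 node (b) of the decomp-pnenp cell; writer g6 rev 7;
critic ruling D24): (I) for a CONCRETE-LANGUAGE residual «NP^O ⊆ P^O → Λ ∈ P^O», a relativization
certificate of the lift IS the absolute lower bound `Λ ∉ P` (content: `P ⊆ P^O`); (II) for an
oracle-free conclusion `Q`, the two-sided certificate of the guarded reading is equivalent to `¬Q`
(one side from the PSPACE collapse world, the other from a Baker–Gill–Solovay separating world).

Port of lens-5 g11 Scope Laws I/II / writer certificate `N3C2_items-g6.lean`
(`certificateScope_holds`). Hypothesis-free; standard axioms only.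
-/

namespace Summit.PneNP.PneNP.Theorems

open Literature.Computability.Complexity

/-- SCOPE clause of the relativization certificate on the class-collapse-lift species: (I) a
certificate for the lift of a FIXED language `Λ` is the lower bound `Λ ∉ P`; (II) for an oracle-free
conclusion `Q` the two-sided certificate is equivalent to `¬Q`. Closes stmt-PneNP-32377. -/
theorem certificateScope_proof :
    Summit.PneNP.PneNP.Theses.RootDecompSpaceCeiling.CertificateScope := by
  unfold Summit.PneNP.PneNP.Theses.RootDecompSpaceCeiling.CertificateScope
  -- the collapse `NP^A ⊆ P^A` holds at the PSPACE-complete oracle `A = SPACETMSAT`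
  have hA : NPRel (Oracle.ofLanguage SPACETMSAT) ⊆ PRel (Oracle.ofLanguage SPACETMSAT) := by
    intro L hL
    rw [PRel_SPACETMSAT_eq_PSPACE.1]
    rw [PRel_SPACETMSAT_eq_PSPACE.2] at hL
    exact hL
  -- some oracle separates: `NP^B ⊄ P^B` (Baker–Gill–Solovay)
  have hB : ∃ B : Language Bool, ¬ (NPRel (Oracle.ofLanguage B) ⊆ PRel (Oracle.ofLanguage B)) := by
    obtain ⟨A, B, -, hB⟩ := baker_gill_solovay
    exact ⟨B, fun h => hB (PRel_eq_NPRel_of_subset h)⟩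
  refine ⟨fun Λ h hP => h (fun B _ => P_subset_PRel_holds _ hP), fun Q => ?_⟩
  constructor
  · rintro ⟨h1, -⟩ hQ
    exact h1 (fun _ _ => hQ)
  · intro hQ
    refine ⟨fun h => hQ (h SPACETMSAT hA), ?_⟩
    obtain ⟨B, hB⟩ := hB
    exact fun h => h B (fun hc => absurd hc hB)

end Summit.PneNP.PneNP.Theorems
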